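import Summits.AtomisticToContinuum.FouriersLaw.Theses.BondHeatUncertainty
import Literature.MathematicalPhysics.KineticTheory.LangevinChainReversal
import Literature.MathematicalPhysics.KineticTheory.LangevinChainLyapunovDrift

/-!
# Kernel-level Gibbs invariance for the pinned chain, part A: the pinned chain on the model-free pipeline

Support file for crux `stmt-AtomisticToContinuum-9120` (`BondHeatUncertainty.SubdiffusiveBondHeat`), line
`bath-bond-deficit-integral`: its fixed-`N` stub `stub_bathBondReduction` (and the honesty of the boundary
kernel `K_N`, step response `θ_N` and escape deficit `E_N` of route `BoundaryEscapeDeficit`, item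
`BoundaryKernelBasics` (a)) needs the invariance of the Gibbs measure under the CONSTRUCTED transition kernels
`OscillatorChain.transitionKernel` at equal bath temperatures. This part puts `pinnedChain ω₂ lam β γ`
(`ω₂ > 0`, `lam, β, γ ≥ 0`) on the model-free SDE pipeline of `LangevinChainConfined.lean`:

* `pinnedChain_isConfining` — the pinned chain has confining potentials (`OscillatorChain.IsConfining`);
* `pinnedChain_langevinKernel_eq_transitionKernel` — the model-free kernels `langevinKernel` (which carry the
  time-reversal / Lebesgue-duality theory of `LangevinChainReversal.lean`) ARE the chain pipeline's
  `transitionKernel` (same Picard limit driven by the same regularised bath noise), exactly as for the purely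
  quartic chain (`PureQuarticKernelIdentification.lean`).
-/

noncomputable section

open MeasureTheory ProbabilityTheory Filter Topology Set
open scoped NNReal ENNReal

namespace Summit.AtomisticToContinuum.FouriersLaw.Theorems.SubdiffusiveBondHeat

open Literature.MathematicalPhysics.KineticTheory.HeatConduction
open Literature.MathematicalPhysics.KineticTheory Literature.Probability.Process OscillatorChain

variable {N : ℕ}

/-! ### The pinned chain has confining potentials -/

/-- `|q|³ ≤ 1 + q⁴`. [folklore] -/
theorem abs_pow_three_le_one_add_pow_four' (q : ℝ) : |q| ^ 3 ≤ 1 + q ^ 4 := by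
  have h4 : q ^ 4 = |q| ^ 4 := by rw [pow_abs, abs_of_nonneg (by positivity : (0:ℝ) ≤ q ^ 4)]
  rw [h4]
  have ha : 0 ≤ |q| := abs_nonneg q
  by_cases h : |q| ≤ 1
  · have : |q| ^ 3 ≤ 1 := pow_le_one₀ ha h
    have : 0 ≤ |q| ^ 4 := by positivity
    linarith
  · push Not at h
    have : |q| ^ 3 ≤ |q| ^ 4 := by
      calc |q| ^ 3 = |q| ^ 3 * 1 := (mul_one _).symm
        _ ≤ |q| ^ 3 * |q| := mul_le_mul_of_nonneg_left h.le (by positivity)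
        _ = |q| ^ 4 := by ring
    linarith

/-- `|q| ≤ (1 + q²)/2`. [folklore] -/
theorem abs_le_half_one_add_sq (q : ℝ) : |q| ≤ (1 + q ^ 2) / 2 := by
  have h : 0 ≤ (|q| - 1) ^ 2 := sq_nonneg _
  have e : q ^ 2 = |q| ^ 2 := (sq_abs q).symm
  nlinarith

/-- **The pinned anharmonic chain has confining potentials** (`ω₂ > 0`, `lam, β, γ ≥ 0`): `U, V` are smooth and
nonnegative, `|U'(q)| = |ω₂ q + lam q³| ≤ (ω₂ + lam + 5)(1 + U(q))`, `|V'(r)| = |r + βr³| ≤ (β + 5)(1 + V(r))`,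
`U(q) ≥ ω₂q²/2 → ∞`. [folklore] -/
theorem pinnedChain_isConfining {ω₂ lam β γ : ℝ} (hω : 0 < ω₂) (hl : 0 ≤ lam) (hβ : 0 ≤ β) (hγ : 0 ≤ γ) :
    (pinnedChain ω₂ lam β γ).IsConfining where
  contDiff_U := pinnedChain_contDiff_U ω₂ lam β γ
  contDiff_V := pinnedChain_contDiff_V ω₂ lam β γ
  γ_nonneg := hγ
  U_nonneg := fun q => by
    show 0 ≤ ω₂ * q ^ 2 / 2 + lam * q ^ 4 / 4
    positivity
  V_nonneg := fun r => by
    show 0 ≤ r ^ 2 / 2 + β * r ^ 4 / 4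
    positivity
  exists_abs_deriv_U_le := by
    refine ⟨ω₂ + lam + 5, by positivity, fun q => ?_⟩
    rw [pinnedChain_deriv_U]
    show |ω₂ * q + lam * q ^ 3| ≤ (ω₂ + lam + 5) * (1 + (ω₂ * q ^ 2 / 2 + lam * q ^ 4 / 4))
    have h1 := abs_pow_three_le_one_add_pow_four' q
    have h2 := abs_le_half_one_add_sq q
    have hq4 : 0 ≤ q ^ 4 := by positivity
    have hq2 : 0 ≤ q ^ 2 := sq_nonneg q
    calc |ω₂ * q + lam * q ^ 3| ≤ |ω₂ * q| + |lam * q ^ 3| := abs_add_le _ _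
      _ = ω₂ * |q| + lam * |q| ^ 3 := by
          rw [abs_mul, abs_mul, abs_of_pos hω, abs_of_nonneg hl, abs_pow]
      _ ≤ ω₂ * ((1 + q ^ 2) / 2) + lam * (1 + q ^ 4) :=
          add_le_add (mul_le_mul_of_nonneg_left h2 hω.le) (mul_le_mul_of_nonneg_left h1 hl)
      _ ≤ (ω₂ + lam + 5) * (1 + (ω₂ * q ^ 2 / 2 + lam * q ^ 4 / 4)) := by
          nlinarith [mul_nonneg hω.le hq2, mul_nonneg hl hq4, mul_nonneg (mul_nonneg hω.le hq2) hl,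
            mul_nonneg (mul_nonneg hl hq4) hω.le, mul_nonneg (mul_nonneg hl hq4) hl,
            mul_nonneg (mul_nonneg hω.le hq2) hω.le]
  exists_abs_deriv_V_le := by
    refine ⟨β + 5, by positivity, fun r => ?_⟩
    rw [pinnedChain_deriv_V]
    show |r + β * r ^ 3| ≤ (β + 5) * (1 + (r ^ 2 / 2 + β * r ^ 4 / 4))
    have h1 := abs_pow_three_le_one_add_pow_four' r
    have h2 := abs_le_half_one_add_sq r
    have hr4 : 0 ≤ r ^ 4 := by positivity
    have hr2 : 0 ≤ r ^ 2 := sq_nonneg r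
    calc |r + β * r ^ 3| ≤ |r| + |β * r ^ 3| := abs_add_le _ _
      _ = |r| + β * |r| ^ 3 := by rw [abs_mul, abs_of_nonneg hβ, abs_pow]
      _ ≤ (1 + r ^ 2) / 2 + β * (1 + r ^ 4) := add_le_add h2 (mul_le_mul_of_nonneg_left h1 hβ)
      _ ≤ (β + 5) * (1 + (r ^ 2 / 2 + β * r ^ 4 / 4)) := by
          nlinarith [mul_nonneg hβ hr4, mul_nonneg hβ hr2, mul_nonneg (mul_nonneg hβ hr4) hβ]
  tendsto_U := by
    have hlow : ∀ q : ℝ, ‖q‖ ^ 2 * (ω₂ / 2) ≤ (pinnedChain ω₂ lam β γ).U q := fun q => by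
      show ‖q‖ ^ 2 * (ω₂ / 2) ≤ ω₂ * q ^ 2 / 2 + lam * q ^ 4 / 4
      rw [Real.norm_eq_abs, sq_abs]
      nlinarith [mul_nonneg hl (by positivity : (0:ℝ) ≤ q ^ 4)]
    refine tendsto_atTop_mono hlow ?_
    exact ((tendsto_pow_atTop (by norm_num : (2:ℕ) ≠ 0)).comp tendsto_norm_cocompact_atTop).atTop_mul_const
      (by positivity)

/-! ### The two transition kernels of the pinned chain agree -/

section Kernels

variable (ω₂ lam β γ : ℝ) (N : ℕ) (T_L T_R : ℝ)

/-- The bath-noise path of the model-free pipeline is the momentum-noise path of the chain pipeline: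
`pairNoise v_L v_R w t = (0, chainNoise N c_L c_R w t)`. [folklore] -/
theorem pinnedChain_pairNoise_eq (w : WienerPair) :
    pairNoise ((pinnedChain ω₂ lam β γ).bathVecL N T_L) ((pinnedChain ω₂ lam β γ).bathVecR N T_R) w =
      fun t => (((0 : Fin N → ℝ),
        chainNoise N (Real.sqrt (2 * γ * T_L)) (Real.sqrt (2 * γ * T_R)) w t) : PhaseSpace N) := by
  funext t
  have hγ : (pinnedChain ω₂ lam β γ).γ = γ := rfl
  simp only [pairNoise, OscillatorChain.bathVecL, OscillatorChain.bathVecR, bathVec, hγ]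
  ext i
  · simp
  · simp only [Prod.snd_add, Prod.smul_snd, Pi.add_apply, Pi.smul_apply, smul_eq_mul, chainNoise]
    ring

/-- **The two solution maps of the pinned chain agree**: the model-free `langevinSolMap` (`drivenFlow` of the drift
driven by `pairNoise`) IS the chain pipeline's `solMap` (`chainFlow` driven by `chainNoise`) — the same Picard
limit. [folklore] -/
theorem pinnedChain_langevinSolMap_eq_solMap :
    (pinnedChain ω₂ lam β γ).langevinSolMap N T_L T_R = (pinnedChain ω₂ lam β γ).solMap N T_L T_R := by
  funext t x w
  unfold OscillatorChain.langevinSolMap sdeSolMap OscillatorChain.solMap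
  rw [pinnedChain_pairNoise_eq]
  rfl

variable {ω₂ lam β γ} (hω : 0 < ω₂) (hl : 0 ≤ lam) (hβ : 0 ≤ β) (hγ : 0 ≤ γ)
include hω hl hβ hγ

/-- **The two transition kernels of the pinned chain agree** (`ω₂ > 0`, `lam, β, γ ≥ 0`): `langevinKernel`
(model-free pipeline) `=` `transitionKernel` (chain pipeline) — both are the law of the same solution map under
the Wiener pair. [folklore] -/
theorem pinnedChain_langevinKernel_eq_transitionKernel (t : ℝ≥0) :
    (pinnedChain ω₂ lam β γ).langevinKernel N T_L T_R t =
      (pinnedChain ω₂ lam β γ).transitionKernel N T_L T_R t := by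
  refine Kernel.ext fun x => ?_
  rw [(pinnedChain_isConfining hω hl hβ hγ).langevinKernel_apply N T_L T_R t x,
    pinnedChain_transitionKernel_apply hω hl hβ hγ N T_L T_R t x,
    pinnedChain_langevinSolMap_eq_solMap ω₂ lam β γ N T_L T_R]

end Kernels


/-! ### The reversed generator on functions of the energy -/

section RevGenerator

variable (P : OscillatorChain) {N : ℕ}

/-- `∂²_{p_i} H = 1`. [folklore] -/
theorem partialP_partialP_hamiltonian (N : ℕ) (x : PhaseSpace N) (i : Fin N) :
    partialP i (partialP i (P.hamiltonian N)) x = 1 := by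
  have h : partialP i (P.hamiltonian N) = fun y => y.2 i := funext fun y => P.partialP_hamiltonian N y i
  rw [h]
  simp only [partialP, Function.update_self]
  exact deriv_id _

/-- `L H = γ ∑_i ([i=0](T_L - p_i²) + [i=N-1](T_R - p_i²))`: only the bath terms act on the energy. [folklore] -/
theorem generator_hamiltonian_eq (N : ℕ) (T_L T_R : ℝ) (x : PhaseSpace N) :
    P.generator N T_L T_R (P.hamiltonian N) x =
      P.γ * ∑ i : Fin N, ((if i.val = 0 then T_L - x.2 i ^ 2 else 0) +
        (if i.val = N - 1 then T_R - x.2 i ^ 2 else 0)) := by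
  rw [P.generator_hamiltonian N T_L T_R x]
  congr 1
  refine Finset.sum_congr rfl fun i _ => ?_
  simp only [partialP_partialP_hamiltonian P, P.partialP_hamiltonian]
  split_ifs <;> ring

/-- `DH(x)·Y(x) = -γ ∑_i w_i p_i²` (the deterministic energy balance at `e = 0`). [folklore] -/
theorem fderiv_hamiltonian_drift (hH : Differentiable ℝ (P.hamiltonian N)) (x : PhaseSpace N) :
    fderiv ℝ (P.hamiltonian N) x (P.drift N x) = -(P.γ * ∑ i, bathWeight N i * x.2 i ^ 2) := by
  rw [P.fderiv_hamiltonian_apply hH]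
  simp only [OscillatorChain.drift]
  rw [Finset.mul_sum, ← Finset.sum_neg_distrib]
  refine Finset.sum_congr rfl fun i _ => ?_
  ring

/-- `DH(x)·(bathVec N k c) = c p_k`. [folklore] -/
theorem fderiv_hamiltonian_bathVec (hH : Differentiable ℝ (P.hamiltonian N)) (x : PhaseSpace N) {k : ℕ}
    (hk : k < N) (c : ℝ) :
    fderiv ℝ (P.hamiltonian N) x (bathVec N k c) = c * x.2 ⟨k, hk⟩ := by
  rw [P.fderiv_hamiltonian_apply hH]
  simp only [bathVec, Pi.zero_apply, mul_zero, zero_add]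
  rw [← sum_ite_val_eq_mul hk c (fun i => x.2 i)]
  refine Finset.sum_congr rfl fun i _ => ?_
  split_ifs <;> ring

/-- `∑_i w_i p_i² = p_0² + p_{N-1}²` (`N ≥ 1`). [folklore] -/
theorem sum_bathWeight_mul_sq (hN : 0 < N) (x : PhaseSpace N) :
    ∑ i, bathWeight N i * x.2 i ^ 2 = x.2 ⟨0, hN⟩ ^ 2 + x.2 ⟨N - 1, Nat.sub_lt hN one_pos⟩ ^ 2 := by
  simp only [bathWeight, add_mul, Finset.sum_add_distrib]
  rw [sum_ite_val_eq_mul hN 1 (fun i => x.2 i ^ 2), sum_ite_val_eq_mul (Nat.sub_lt hN one_pos) 1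
    (fun i => x.2 i ^ 2)]
  ring

variable {P}

/-- **The reversed generator of a function of the energy.** For `C²` potentials, `N ≥ 1`, `γT_L, γT_R ≥ 0` and
`F` twice differentiable, with `A = p_0²`, `B = p_{N-1}²`:
`L̂ (F∘H) = γ [F'(H) (T_L + T_R + A + B) + F''(H) (T_L A + T_R B)]`, where
`L̂ = sdeGenerator (-Y) v_L v_R` is the generator of the time-reversed Langevin equation (chain rule
`sdeGenerator_comp`, `L̂H = LH - 2 DH·Y = γ(T_L + T_R) + γ(A + B)`, `(DH·v_b)² = 2γT_b p_b²`). [folklore] -/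
theorem revGenerator_comp_hamiltonian (hU : ContDiff ℝ 2 P.U) (hV : ContDiff ℝ 2 P.V) (hN : 0 < N)
    {T_L T_R : ℝ} (hL : 0 ≤ P.γ * T_L) (hR : 0 ≤ P.γ * T_R) {F F' F'' : ℝ → ℝ}
    (hF : ∀ u, HasDerivAt F (F' u) u) (hF' : ∀ u, HasDerivAt F' (F'' u) u) (x : PhaseSpace N) :
    sdeGenerator (fun y => -P.drift N y) (P.bathVecL N T_L) (P.bathVecR N T_R)
        (fun y => F (P.hamiltonian N y)) x =
      P.γ * (F' (P.hamiltonian N x) *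
          (T_L + T_R + x.2 ⟨0, hN⟩ ^ 2 + x.2 ⟨N - 1, Nat.sub_lt hN one_pos⟩ ^ 2) +
        F'' (P.hamiltonian N x) *
          (T_L * x.2 ⟨0, hN⟩ ^ 2 + T_R * x.2 ⟨N - 1, Nat.sub_lt hN one_pos⟩ ^ 2)) := by
  have hH2 : ContDiff ℝ 2 (P.hamiltonian N) := P.contDiff_hamiltonian hU hV N
  have hHd : Differentiable ℝ (P.hamiltonian N) := hH2.differentiable (by norm_num)
  rw [sdeGenerator_comp (fun y => -P.drift N y) _ _ hF hF' hH2 x]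
  -- the reversed generator of `H`
  have hrev : sdeGenerator (fun y => -P.drift N y) (P.bathVecL N T_L) (P.bathVecR N T_R)
      (P.hamiltonian N) x =
      sdeGenerator (P.drift N) (P.bathVecL N T_L) (P.bathVecR N T_R) (P.hamiltonian N) x -
        2 * fderiv ℝ (P.hamiltonian N) x (P.drift N x) := by
    rw [sdeGenerator_def, sdeGenerator_def, map_neg]
    ring
  have hgen : sdeGenerator (P.drift N) (P.bathVecL N T_L) (P.bathVecR N T_R) (P.hamiltonian N) x =
      P.generator N T_L T_R (P.hamiltonian N) x := by
    rw [P.sdeGenerator_drift_eq_generator hN hL hR hH2]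
  have hA : fderiv ℝ (P.hamiltonian N) x (P.bathVecL N T_L) = Real.sqrt (2 * P.γ * T_L) * x.2 ⟨0, hN⟩ :=
    fderiv_hamiltonian_bathVec P hHd x hN _
  have hB : fderiv ℝ (P.hamiltonian N) x (P.bathVecR N T_R) =
      Real.sqrt (2 * P.γ * T_R) * x.2 ⟨N - 1, Nat.sub_lt hN one_pos⟩ :=
    fderiv_hamiltonian_bathVec P hHd x (Nat.sub_lt hN one_pos) _
  have hsum : ∑ i : Fin N, ((if i.val = 0 then T_L - x.2 i ^ 2 else 0) +
      (if i.val = N - 1 then T_R - x.2 i ^ 2 else 0)) =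
      (T_L - x.2 ⟨0, hN⟩ ^ 2) + (T_R - x.2 ⟨N - 1, Nat.sub_lt hN one_pos⟩ ^ 2) := by
    rw [Finset.sum_add_distrib]
    have e1 : ∑ i : Fin N, (if i.val = 0 then T_L - x.2 i ^ 2 else 0) =
        ∑ i : Fin N, (if i.val = 0 then (1:ℝ) else 0) * (T_L - x.2 i ^ 2) :=
      Finset.sum_congr rfl fun i _ => by split_ifs <;> simp
    have e2 : ∑ i : Fin N, (if i.val = N - 1 then T_R - x.2 i ^ 2 else 0) =
        ∑ i : Fin N, (if i.val = N - 1 then (1:ℝ) else 0) * (T_R - x.2 i ^ 2) :=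
      Finset.sum_congr rfl fun i _ => by split_ifs <;> simp
    rw [e1, e2, sum_ite_val_eq_mul hN 1 (fun i => T_L - x.2 i ^ 2),
      sum_ite_val_eq_mul (Nat.sub_lt hN one_pos) 1 (fun i => T_R - x.2 i ^ 2)]
    ring
  rw [hrev, hgen, generator_hamiltonian_eq P, fderiv_hamiltonian_drift P hHd, sum_bathWeight_mul_sq hN,
    hsum, hA, hB, mul_pow, mul_pow, Real.sq_sqrt (by linarith), Real.sq_sqrt (by linarith)]
  ring

/-- **`e^{-H/T}` is an eigenfunction of the reversed generator at equal bath temperatures**: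
`L̂ e^{-H/T} = -2γ e^{-H/T}` (`N ≥ 1`, `γ ≥ 0`, `T > 0`) — the infinitesimal form of the invariance of the
Gibbs density, `Lᵀ = L̂ + 2γ` being the formal transpose of the generator for Lebesgue measure.
[cite: CuneoEckmannHairerReyBellet2018, §3.1] -/
theorem revGenerator_gibbsDensity (hU : ContDiff ℝ 2 P.U) (hV : ContDiff ℝ 2 P.V) (hN : 0 < N)
    (hγ : 0 ≤ P.γ) {T : ℝ} (hT : 0 < T) (x : PhaseSpace N) :
    sdeGenerator (fun y => -P.drift N y) (P.bathVecL N T) (P.bathVecR N T) (P.gibbsDensity N T) x =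
      -(2 * P.γ) * P.gibbsDensity N T x := by
  have hF : ∀ u : ℝ, HasDerivAt (fun h => Real.exp (-h / T)) (-(1 / T) * Real.exp (-u / T)) u := fun u => by
    have h1 : HasDerivAt (fun h : ℝ => -h / T) (-1 / T) u := by
      simpa using ((hasDerivAt_id u).neg).div_const T
    exact h1.exp.congr_deriv (by ring)
  have hF' : ∀ u : ℝ, HasDerivAt (fun h => -(1 / T) * Real.exp (-h / T))
      ((1 / T ^ 2) * Real.exp (-u / T)) u := fun u =>
    ((hF u).const_mul (-(1 / T))).congr_deriv (by ring)
  have hTγ : 0 ≤ P.γ * T := mul_nonneg hγ hT.le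
  have h := revGenerator_comp_hamiltonian hU hV hN hTγ hTγ hF hF' x
  have e : P.gibbsDensity N T = fun y => Real.exp (-P.hamiltonian N y / T) := rfl
  rw [e, h]
  field_simp
  ring

end RevGenerator

end Summit.AtomisticToContinuum.FouriersLaw.Theorems.SubdiffusiveBondHeat

end
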